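import Summits.QuantumFields.YangMills.Theorems.LuscherReductionTwistedTraceScalingFloorNormalisation
import Summits.QuantumFields.YangMills.Theorems.TwistedTraceScaling.Negative.IdealFloorLedger
import Summits.QuantumFields.YangMills.Theorems.TwistedTraceScaling.Negative.InnerValleyTargetsGuards
import HarnessLib

/-!
# R16 (crux `TwistedTraceScaling`, stmt-QuantumFields-20203): lane A's landed F7 `riccatiN_idealCmp_pow` is SHARP in its ledger hypotheses, and the
# ★★★★★ door `coarseNoIntruderAt_of_inner_pow` (COARSE-UPPER(L) ⇐ INNER one-orbit alone) is LIVE EXACTLY on `0 < p < 2/51` — by name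

Standing disprover `ym-cdisprove-20203-1` (gen 15), sequel to `…Negative.IdealFloorLedger` (R14, p593188/p593600) and `…Negative.FloorRouteCeiling(Pow)` (R15).
Lane A (gen 10) landed the k = 0 floor route end to end: `…FloorAssembly` (p597156: `idealFloorLevel` = `Λ_id`, ★★★★ `vacuumFloorAt_ideal`,
`coarseNoIntruderAt_of_idealCmp_pow`) and `…FloorNormalisation` (p597574: ★★★ `riccatiN_idealCmp_pow (hp : 0 < p) (hpm : p < m/2) (hrq : 2r < q)
(hC : 1 + 3m − 3r < −p) (hm : 0 ≤ m)` — the normalisation comparison `N_B·e^{−6Z₀} ≤ Λ_id·e^{εβ^{−p}}` — and ★★★★★ `coarseNoIntruderAt_of_inner_pow (hL : 2 ≤ L)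
(hp0 : 0 < p) (hp : p < 1/10) (hpq : 4p < q) (hq : q < 8/9) (hr : 0 < r) (hr1 : 2r < 1) (hm : 0 < m) (hrq : 2r < q − m/2) (hpm : p < m/2) (hC : 1 + 3m − 3r < −p)
(hI : InnerNoIntruderOneOrbitAt L (powScale p))` : COARSE-UPPER(L)).  F7 carries R14's ledger `2p < m ∧ 1 + 3m + p < 3r` verbatim (as `hpm`, `hC`).  This file
records, BY NAME on the landed declarations:
* §1 `idealFloorLevel_eq` — lane A's `idealFloorLevel L β` IS R14's `Λ_id(β) = (e^{2β}√(π/β)³/(2π²))^{|E|}·e^{−6·toronZPE L (1/2) 0 0}` (spelling bridge), hence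
  ★ `riccatiN_idealCmp_false_off_ledger (L) (hr : 0 ≤ r) (hm : 0 ≤ m) (h : m ≤ 2p ∨ 3r ≤ 1 + 3m + p)` : the CONCLUSION of `riccatiN_idealCmp_pow` is FALSE — its
  hypotheses `hpm`, `hC` cannot be weakened to `≤` (edges `riccatiN_idealCmp_false_at_edge_m` : `m = 2p`, `riccatiN_idealCmp_false_at_edge_r` : `3r = 1 + 3m + p`),
  at EVERY `L ≥ 1` and every `q`; `ledger_of_riccatiN_idealCmp` : the conclusion implies `2p < m ∧ 1 + 3m + p < 3r`.  (R14 transported through §1's bridge.)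
* §2 the WINDOW of the ★★★★★ door: `innerPow_hypotheses_window (hq) (hrq) (hpm) (hC) : p < 2/51 ∧ 2/3 + 17p/3 < q ∧ (1 + 7p)/3 < r < 4/9 − p/2 ∧ m < 4/45 − 4p/15`
  (four of its ten exponent hypotheses already force this); ★ `innerPow_door_shut_above (hp : 2/51 ≤ p)` : NO `(q, r, m)` satisfies the ten hypotheses — on
  `[2/51, 1/10)` the theorem is VACUOUS, its typed `p < 1/10` is immaterial; `innerPow_window_nonempty_iff : (∃ q r m, the ten hypotheses) ↔ 0 < p < 2/51`
  (witness `(q, r, m) = (8/9 − s, (1 + 7p)/3 + 2s, 2p + s)`, `s = 2/51 − p`; lane A's `innerPow_window_nonempty` is the point `p = 1/40`).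
* §3 the door AT THE EDGE: `coarseUpper_of_inner_pow (hL : 2 ≤ L) (hp0 : 0 < p) (hp : p < 2/51) (hI : InnerNoIntruderOneOrbitAt L (powScale p))` : COARSE-UPPER(L)
  — lane A's ★★★★★ with the exponents eliminated; and, INNER being ANTITONE in the box (`R6.innerNoIntruderOneOrbitAt_anti`: a smaller box is easier),
  `coarseUpper_of_inner_le (hδ : ∃ p < 2/51, ∀ β, powScale p β ≤ δ β) (hI : InnerNoIntruderOneOrbitAt L δ)` : any box radius `δ(β) ≥ β^{−p}` with some `p < 2/51` feeds
  the door; a C4 proof with a box `β^{−p}`, `p ≥ 2/51`, does NOT (§2), and antitonicity runs the wrong way to repair it.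
READING (for OWNER / LEAD twolattice / the C4 prover).  C3 is closed modulo C4 exactly as announced; the kernel-checked net statement is
`∀ L ≥ 2, COARSE-UPPER(L) ⇐ InnerNoIntruderOneOrbitAt L (β^{−p})` for ANY ONE `p ∈ (0, 2/51)` — the ceiling `2/51 ≈ 0.0392` is lane B's UPPER exponents (`q < 8/9`,
`2r < q − m/2`) meeting the floor ledger (`2p < m`, `1 + 3m + p < 3r`), not a property of INNER.  Consequence for C4 as CONSUMED here: the trial families to be
excluded are supported in `{orbitDist < β^{−p}}` with `p < 2/51`, a neighbourhood of the trivial orbit that contains the femto cloud (`orbitDist ≍ L²β^{−1/3}`), the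
valley out to constant-mode angles `≍ β^{−p}/L³ ≫ β^{−1/4}` (the valley width) and every near-vacuum stiff excitation — C4 is a GLOBAL Born–Oppenheimer statement on
that region (valley states must be shown NOT to intrude from above the `k`-th femto level; on paper they do not: their adiabatic excess `≍ r·λ_b`, `r → ∞`, §I of the
disprover's work file), not a harmonic-neighbourhood statement.  NO KILL: `riccatiN_idealCmp_pow` is true as stated (kernel), sharp by §1; the door is consistent;
INNER (C4) untouched and plausible (§I).  HONEST FRAMING: exponent bookkeeping about the typed inputs of a stub lane (S-BASE C3/C4) of a child of the CONDITIONAL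
reduction route (femto rung R2b1); not `¬TwistedTraceScaling`, not infinite volume, not a gap, not Clay.  Sorry-free, no new definition; axioms ⊆ {propext,
Classical.choice, Quot.sound}.
-/

set_option autoImplicit false

noncomputable section

open Real
open Literature.MathematicalPhysics.QuantumFieldTheory
open Literature.MathematicalPhysics.QuantumLattice
open Summit.QuantumFields.YangMills.Theorems.FemtoTransferGap
open Summit.QuantumFields.YangMills.Theorems.FemtoTransferGap.TwoLattice
open Summit.QuantumFields.YangMills.Theorems.FemtoTransferGap.TwoLattice.Toron
open Summit.QuantumFields.YangMills.Theorems.FemtoTransferGap.TwoLattice.Cov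

namespace Summit.QuantumFields.YangMills.Theorems.TwistedTraceScaling.Negative.R16

/-! ## §1 Lane A's `idealFloorLevel` is R14's `Λ_id`; F7's ledger hypotheses are necessary -/

/-- **Spelling bridge**: `idealFloorLevel L β = (e^{2β}·√(π/β)³/(2π²))^{|E|}·e^{−6·toronZPE L (1/2) 0 0}` (R14's `Λ_id`). [folklore] -/
theorem idealFloorLevel_eq (L : ℕ) [NeZero L] (β : ℝ) :
    idealFloorLevel L β =
      (Real.exp (2 * β) * Real.sqrt (π / β) ^ 3 / (2 * π ^ 2)) ^ Fintype.card (Edge 3 L) * Real.exp (-(6 * toronZPE L (1 / 2) 0 0)) := by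
  unfold idealFloorLevel
  rw [mul_comm (Fintype.card (Edge 3 L)) 3, pow_mul]
  ring

/-- ★ **F7'S CONCLUSION IS FALSE OFF THE LEDGER** (every `L ≥ 1`, every `q`; `r, m ≥ 0`): if `m ≤ 2p` or `3r ≤ 1 + 3m + p` then
`¬ ∀ ε > 0, eventually riccatiN L β (β^{−r}) (2β^{−q}) (β^{−m})·e^{−6Z₀} ≤ idealFloorLevel L β·e^{εβ^{−p}}` — the hypotheses `hpm : p < m/2` and
`hC : 1 + 3m − 3r < −p` of `riccatiN_idealCmp_pow` cannot be weakened (R14 `idealFloor_comparison_false` through the bridge). [cite: Luscher1983, §3] -/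
theorem riccatiN_idealCmp_false_off_ledger (L : ℕ) [NeZero L] {p q r m : ℝ} (hr : 0 ≤ r) (hm : 0 ≤ m)
    (h : m ≤ 2 * p ∨ 3 * r ≤ 1 + 3 * m + p) :
    ¬ ∀ ε : ℝ, 0 < ε → ∃ β0 : ℝ, ∀ β : ℝ, β0 ≤ β →
      riccatiN L β (powScale r β) (2 * powScale q β) (powScale m β) * Real.exp (-(6 * toronZPE L (1 / 2) 0 0)) ≤
        idealFloorLevel L β * Real.exp (ε * powScale p β) := by
  intro hcmp
  refine R14.idealFloor_comparison_false L (q := q) hr hm h (fun ε hε => ?_)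
  obtain ⟨β0, hβ0⟩ := hcmp ε hε
  refine ⟨β0, fun β hβ => ?_⟩
  rw [← idealFloorLevel_eq]
  exact hβ0 β hβ

/-- **Ledger from F7's conclusion** (every `L ≥ 1`; `r, m ≥ 0`): the comparison with `idealFloorLevel` implies `2p < m ∧ 1 + 3m + p < 3r`. [cite: Luscher1983, §3] -/
theorem ledger_of_riccatiN_idealCmp (L : ℕ) [NeZero L] {p q r m : ℝ} (hr : 0 ≤ r) (hm : 0 ≤ m)
    (hcmp : ∀ ε : ℝ, 0 < ε → ∃ β0 : ℝ, ∀ β : ℝ, β0 ≤ β →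
      riccatiN L β (powScale r β) (2 * powScale q β) (powScale m β) * Real.exp (-(6 * toronZPE L (1 / 2) 0 0)) ≤
        idealFloorLevel L β * Real.exp (ε * powScale p β)) :
    2 * p < m ∧ 1 + 3 * m + p < 3 * r := by
  by_contra hneg
  have h : m ≤ 2 * p ∨ 3 * r ≤ 1 + 3 * m + p := by
    rcases not_and_or.mp hneg with h1 | h1
    · exact Or.inl (not_lt.mp h1)
    · exact Or.inr (not_lt.mp h1)
  exact riccatiN_idealCmp_false_off_ledger L hr hm h hcmp

/-- **Edge `m = 2p`**: with `hpm` relaxed to equality the conclusion of `riccatiN_idealCmp_pow` fails (any `p ≥ 0`, `r ≥ 0`, `q`; every `L ≥ 1`). -/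
theorem riccatiN_idealCmp_false_at_edge_m (L : ℕ) [NeZero L] {p q r : ℝ} (hp : 0 ≤ p) (hr : 0 ≤ r) :
    ¬ ∀ ε : ℝ, 0 < ε → ∃ β0 : ℝ, ∀ β : ℝ, β0 ≤ β →
      riccatiN L β (powScale r β) (2 * powScale q β) (powScale (2 * p) β) * Real.exp (-(6 * toronZPE L (1 / 2) 0 0)) ≤
        idealFloorLevel L β * Real.exp (ε * powScale p β) :=
  riccatiN_idealCmp_false_off_ledger L hr (by linarith) (Or.inl le_rfl)

/-- **Edge `3r = 1 + 3m + p`**: with `hC` relaxed to equality the conclusion of `riccatiN_idealCmp_pow` fails (any `m ≥ 0`, `p ≥ 0`, `q`; every `L ≥ 1`). -/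
theorem riccatiN_idealCmp_false_at_edge_r (L : ℕ) [NeZero L] {p q m : ℝ} (hp : 0 ≤ p) (hm : 0 ≤ m) :
    ¬ ∀ ε : ℝ, 0 < ε → ∃ β0 : ℝ, ∀ β : ℝ, β0 ≤ β →
      riccatiN L β (powScale ((1 + 3 * m + p) / 3) β) (2 * powScale q β) (powScale m β) * Real.exp (-(6 * toronZPE L (1 / 2) 0 0)) ≤
        idealFloorLevel L β * Real.exp (ε * powScale p β) :=
  riccatiN_idealCmp_false_off_ledger L (by positivity) hm (Or.inr (by linarith))

/-! ## §2 The window of the ★★★★★ door `coarseNoIntruderAt_of_inner_pow` -/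

/-- **Window**: four of the ten exponent hypotheses of `coarseNoIntruderAt_of_inner_pow` (`hq`, `hrq`, `hpm`, `hC`) already confine the exponents to
`p < 2/51`, `2/3 + 17p/3 < q`, `(1 + 7p)/3 < r < 4/9 − p/2`, `m < 4/45 − 4p/15`. [folklore] -/
theorem innerPow_hypotheses_window {p q r m : ℝ} (hq : q < 8 / 9) (hrq : 2 * r < q - m / 2) (hpm : p < m / 2)
    (hC : 1 + 3 * m - 3 * r < -p) :
    p < 2 / 51 ∧ 2 / 3 + 17 * p / 3 < q ∧ (1 + 7 * p) / 3 < r ∧ r < 4 / 9 - p / 2 ∧ m < 4 / 45 - 4 * p / 15 :=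
  R14.idealFloor_handover_window hq hrq ⟨by linarith, by linarith⟩

/-- ★ **THE DOOR IS SHUT FOR `p ≥ 2/51`**: no `(q, r, m)` satisfies the ten exponent hypotheses of `coarseNoIntruderAt_of_inner_pow` — on `[2/51, 1/10)`
the ★★★★★ theorem is vacuous. [folklore] -/
theorem innerPow_door_shut_above {p : ℝ} (hp : 2 / 51 ≤ p) :
    ¬ ∃ q r m : ℝ, 0 < p ∧ p < 1 / 10 ∧ 4 * p < q ∧ q < 8 / 9 ∧ 0 < r ∧ 2 * r < 1 ∧ 0 < m ∧ 2 * r < q - m / 2 ∧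
      p < m / 2 ∧ 1 + 3 * m - 3 * r < -p := by
  rintro ⟨q, r, m, -, -, -, hq, -, -, -, hrq, hpm, hC⟩
  have h := (innerPow_hypotheses_window hq hrq hpm hC).1
  linarith

/-- **The window is non-empty exactly for `0 < p < 2/51`** (witness `q = 8/9 − s`, `r = (1 + 7p)/3 + 2s`, `m = 2p + s`, `s = 2/51 − p`). [folklore] -/
theorem innerPow_window_nonempty_iff {p : ℝ} :
    (∃ q r m : ℝ, 0 < p ∧ p < 1 / 10 ∧ 4 * p < q ∧ q < 8 / 9 ∧ 0 < r ∧ 2 * r < 1 ∧ 0 < m ∧ 2 * r < q - m / 2 ∧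
      p < m / 2 ∧ 1 + 3 * m - 3 * r < -p) ↔ 0 < p ∧ p < 2 / 51 := by
  constructor
  · rintro ⟨q, r, m, hp0, -, -, hq, -, -, -, hrq, hpm, hC⟩
    exact ⟨hp0, (innerPow_hypotheses_window hq hrq hpm hC).1⟩
  · rintro ⟨hp0, hp⟩
    refine ⟨8 / 9 - (2 / 51 - p), (1 + 7 * p) / 3 + 2 * (2 / 51 - p), 2 * p + (2 / 51 - p), hp0, by linarith, by linarith, by linarith,
      by linarith, by linarith, by linarith, by linarith, by linarith, by linarith⟩

/-- Numerically: the admissible `p` stop at `2/51 = 0.0392…`; lane A's typed bound `1/10` and the crux-scale `1/3` are out of reach of this door. -/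
example : (2 : ℝ) / 51 < 1 / 10 ∧ (0.039 : ℝ) < 2 / 51 ∧ (2 : ℝ) / 51 < 0.0393 := by norm_num

/-! ## §3 The door at the edge of the window -/

/-- **COARSE-UPPER(L) ⇐ INNER one-orbit at ANY `p ∈ (0, 2/51)`** (`L ≥ 2`): lane A's ★★★★★ `coarseNoIntruderAt_of_inner_pow` with the exponents eliminated
(`(q, r, m) = (8/9 − s, (1 + 7p)/3 + 2s, 2p + s)`, `s = 2/51 − p`). [cite: Luscher1983, §3] [cite: LuscherMunster1984, §2] -/
theorem coarseUpper_of_inner_pow {L : ℕ} [NeZero L] (hL : 2 ≤ L) {p : ℝ} (hp0 : 0 < p) (hp : p < 2 / 51)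
    (hI : InnerNoIntruderOneOrbitAt L (powScale p)) :
    ∀ k : ℕ, ∀ d : ℝ, d < levelGap k → ∃ lam0 : ℝ, 0 < lam0 ∧ ∀ lam : ℝ, 0 < lam → lam ≤ lam0 →
      ∀ β : ℝ, InFemtoWindow lam β L →
        levelValue su2Rep L β k ≤ Real.exp (-(d * luscherLambda β L) / L) * levelValue su2Rep L β 0 :=
  coarseNoIntruderAt_of_inner_pow hL (q := 8 / 9 - (2 / 51 - p)) (r := (1 + 7 * p) / 3 + 2 * (2 / 51 - p)) (m := 2 * p + (2 / 51 - p))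
    hp0 (by linarith) (by linarith) (by linarith) (by linarith) (by linarith) (by linarith) (by linarith) (by linarith) (by linarith) hI

/-- **Any box at least `β^{−p}` wide for some `p < 2/51` feeds the door** (`L ≥ 2`; INNER is antitone in the box radius, `R6.innerNoIntruderOneOrbitAt_anti`).
A C4 proof with box `β^{−p}`, `p ≥ 2/51`, does not (§2). [cite: Luscher1983, §3] -/
theorem coarseUpper_of_inner_le {L : ℕ} [NeZero L] (hL : 2 ≤ L) {δ : ℝ → ℝ}
    (hδ : ∃ p : ℝ, 0 < p ∧ p < 2 / 51 ∧ ∀ β, powScale p β ≤ δ β) (hI : InnerNoIntruderOneOrbitAt L δ) :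
    ∀ k : ℕ, ∀ d : ℝ, d < levelGap k → ∃ lam0 : ℝ, 0 < lam0 ∧ ∀ lam : ℝ, 0 < lam → lam ≤ lam0 →
      ∀ β : ℝ, InFemtoWindow lam β L →
        levelValue su2Rep L β k ≤ Real.exp (-(d * luscherLambda β L) / L) * levelValue su2Rep L β 0 := by
  obtain ⟨p, hp0, hp, hle⟩ := hδ
  exact coarseUpper_of_inner_pow hL hp0 hp (R6.innerNoIntruderOneOrbitAt_anti hle hI)

end Summit.QuantumFields.YangMills.Theorems.TwistedTraceScaling.Negative.R16

end
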